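import Mathlib
import HarnessLib
import Literature.Probability.Distributions.GaussianWidthStatDist
import Summits.Ventures.LatticeQCDFlow.Scoring.GaussianStudentScaleMixture
import Summits.Ventures.LatticeQCDFlow.Scoring.GaussianStudentCountMonotone
import Summits.Ventures.LatticeQCDFlow.Scoring.GaussianWelchScaleMixture

/-!
# BOUNDS FOR THE UNEQUAL-COUNT TWO-ARM (WELCH-TYPE) CALIBRATION:
# `λ·L_a(t) + λ'·L_b(t) ≤ W ≤ N(0,1)([−t, t])`, HENCE `L_{min(a,b)}(t) ≤ W` (HSU'S CONSERVATIVE RULE)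

HONEST FRAMING: exact (Metropolis-corrected) sampling algorithms for lattice gauge theory;
figures of merit are autocorrelation/cost numbers at stated couplings and volumes; no
continuum-physics claim.

Venture `LatticeQCDFlow` (cell pub-lqcd), topic `Scoring`; FANOUT row 4 (`s0-u1-b`, GEN-33).
NEW WORK of the cell (classical; not in Mathlib), no definition, nothing cited as a fact (Hsu 1938 /
Scheffé 1970 on the Behrens–Fisher problem are NAMED ONLY).

WHY (row 4).  `W = (N^{⊗a} ⊗ N^{⊗b}){(αḡ − βh̄)² ≤ t²(α²s²(g)/a + β²s²(h)/b)}` is the limiting pass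
probability of row 4's A-vs-B criterion with `a = n + 1` and `b = m + 1` batches in the two arms
and asymptotic standard deviations `α, β` (`Scoring/GaussianWelchScaleMixture`: `W = E ψ_t(λV₁ + λ'V₂)`).
Two consequences of the concavity of `ψ_t` on `[0, ∞)` (`Scoring/GaussianStudentScaleMixture`):
(LOWER) pointwise `ψ_t(λV₁ + λ'V₂) ≥ λψ_t(V₁) + λ'ψ_t(V₂)`, and `E ψ_t(V₁) = L_a(t)`,
`E ψ_t(V₂) = L_b(t)` are the one-arm Student-ratio probabilities, so `W ≥ λL_a(t) + λ'L_b(t)`; with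
the monotonicity of `L` in the count (`Scoring/GaussianStudentCountMonotone`) this is at least
`L_{min(a,b)}(t)`: reading the bar with the Student-type quantile of `min(a,b) − 1` degrees of
freedom is CONSERVATIVE for every variance ratio (Hsu's rule); (UPPER) Jensen
(`ConcaveOn.le_map_integral`, `E(λV₁ + λ'V₂) = 1`): `W ≤ ψ_t(1) = N(0,1)([−t, t])` — the normal
quantile never over-covers, for every pair of counts and every variance ratio.

## Content

* `pi_sum_integral_inl`, `pi_sum_integral_inr` (§1) — marginal integrals over
  `N(0,1)^{⊗(Fin n ⊕ Fin m)}` (`measurePreserving_sumPiEquivProdPi`, `measurePreserving_fst/snd`).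
* **`pi_gaussianReal_welch_ge_mixture`** (§1) — `λ·L_a(t) + λ'·L_b(t) ≤ W` (`t ≥ 0`).
* **`pi_gaussianReal_welch_le_gaussian`** (§1) — `W ≤ N(0,1)([−t, t])` (`t ≥ 0`, `n, m ≥ 1`).
* **`pi_gaussianReal_welch_ge_left`** / **`_right`** (§1) — `L_a(t) ≤ W` if `a ≤ b`, `L_b(t) ≤ W` if
  `b ≤ a` (split Student-ratio form `N^{⊗(k+1)}{|z₀| ≤ t√((Σ_{j≥1} z_j²)/k)}`; by
  `Scoring/GaussianStudentEventReduction` these are row 4's / row 13's `F_k = L_k`).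

NOT CLAIMED: the exact value of `W` (Behrens–Fisher); Welch–Satterthwaite degrees of freedom;
anything numerical.
-/

open MeasureTheory ProbabilityTheory Filter Topology Finset

namespace Summit.Ventures.LatticeQCDFlow.Scoring

open Set WithLp

/-! ## §1 Bounds: `λ L_a(t) + λ' L_b(t) ≤ W ≤ N(0,1)([−t, t])`, and Hsu's rule -/

section Bounds

/-- The integral of a function of the `inl`-coordinates over `N(0,1)^{⊗(Fin n ⊕ Fin m)}` is its
integral over `N(0,1)^{⊗n}`. [ours] -/
theorem pi_sum_integral_inl {n m : ℕ} (g : (Fin n → ℝ) → ℝ)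
    (hg : AEStronglyMeasurable g (Measure.pi fun _ : Fin n => gaussianReal 0 1)) :
    ∫ w, g (fun j => w (Sum.inl j)) ∂(Measure.pi fun _ : Fin n ⊕ Fin m => gaussianReal 0 1)
      = ∫ y, g y ∂(Measure.pi fun _ : Fin n => gaussianReal 0 1) := by
  have hσ := measurePreserving_sumPiEquivProdPi fun _ : Fin n ⊕ Fin m => gaussianReal 0 1
  have h1 : ∫ w, g (fun j => w (Sum.inl j)) ∂(Measure.pi fun _ : Fin n ⊕ Fin m => gaussianReal 0 1)
      = ∫ w, (fun p : (Fin n → ℝ) × (Fin m → ℝ) => g p.1)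
          (MeasurableEquiv.sumPiEquivProdPi (fun _ : Fin n ⊕ Fin m => ℝ) w)
            ∂(Measure.pi fun _ : Fin n ⊕ Fin m => gaussianReal 0 1) := rfl
  rw [h1, hσ.integral_comp' (fun p : (Fin n → ℝ) × (Fin m → ℝ) => g p.1)]
  have hfst : MeasurePreserving (Prod.fst : (Fin n → ℝ) × (Fin m → ℝ) → (Fin n → ℝ))
      ((Measure.pi fun _ : Fin n => gaussianReal 0 1).prod (Measure.pi fun _ : Fin m => gaussianReal 0 1))
      (Measure.pi fun _ : Fin n => gaussianReal 0 1) := measurePreserving_fst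
  conv_rhs => rw [← hfst.map_eq]
  rw [integral_map measurable_fst.aemeasurable (by rwa [hfst.map_eq])]

/-- The same for the `inr`-coordinates. [ours] -/
theorem pi_sum_integral_inr {n m : ℕ} (g : (Fin m → ℝ) → ℝ)
    (hg : AEStronglyMeasurable g (Measure.pi fun _ : Fin m => gaussianReal 0 1)) :
    ∫ w, g (fun j => w (Sum.inr j)) ∂(Measure.pi fun _ : Fin n ⊕ Fin m => gaussianReal 0 1)
      = ∫ y, g y ∂(Measure.pi fun _ : Fin m => gaussianReal 0 1) := by
  have hσ := measurePreserving_sumPiEquivProdPi fun _ : Fin n ⊕ Fin m => gaussianReal 0 1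
  have h1 : ∫ w, g (fun j => w (Sum.inr j)) ∂(Measure.pi fun _ : Fin n ⊕ Fin m => gaussianReal 0 1)
      = ∫ w, (fun p : (Fin n → ℝ) × (Fin m → ℝ) => g p.2)
          (MeasurableEquiv.sumPiEquivProdPi (fun _ : Fin n ⊕ Fin m => ℝ) w)
            ∂(Measure.pi fun _ : Fin n ⊕ Fin m => gaussianReal 0 1) := rfl
  rw [h1, hσ.integral_comp' (fun p : (Fin n → ℝ) × (Fin m → ℝ) => g p.2)]
  have hsnd : MeasurePreserving (Prod.snd : (Fin n → ℝ) × (Fin m → ℝ) → (Fin m → ℝ))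
      ((Measure.pi fun _ : Fin n => gaussianReal 0 1).prod (Measure.pi fun _ : Fin m => gaussianReal 0 1))
      (Measure.pi fun _ : Fin m => gaussianReal 0 1) := measurePreserving_snd
  conv_rhs => rw [← hsnd.map_eq]
  rw [integral_map measurable_snd.aemeasurable (by rwa [hsnd.map_eq])]

/-- **LOWER BOUND (Hsu-type): the unequal-count two-arm criterion covers at least the
`λ, λ'`-mixture of the two one-arm Student-ratio probabilities** (`t ≥ 0`, arms `a = n+1`,
`b = m+1`, weights with `τ² = α²/a + β²/b > 0`, `λ = (α²/a)/τ²`, `λ' = (β²/b)/τ²`):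
`λ·N^{⊗a}{|z₀| ≤ t√((Σ_{j≥1} z_j²)/n)} + λ'·N^{⊗b}{|z₀| ≤ t√((Σ_{j≥1} z_j²)/m)} ≤ W`
(pointwise concavity of `ψ_t`, `Scoring/GaussianStudentScaleMixture`). [ours] -/
theorem pi_gaussianReal_welch_ge_mixture {t : ℝ} (ht : 0 ≤ t) (n m : ℕ)
    {α β : ℝ} (hτ : 0 < α ^ 2 / ((n + 1 : ℕ) : ℝ) + β ^ 2 / ((m + 1 : ℕ) : ℝ)) :
    (α ^ 2 / ((n + 1 : ℕ) : ℝ)) / (α ^ 2 / ((n + 1 : ℕ) : ℝ) + β ^ 2 / ((m + 1 : ℕ) : ℝ))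
        * ((Measure.pi fun _ : Fin (n + 1) => gaussianReal 0 1)
          {z : Fin (n + 1) → ℝ | |z 0| ≤ t * Real.sqrt ((∑ j : Fin n, z j.succ ^ 2) / (n : ℝ))}).toReal
      + (β ^ 2 / ((m + 1 : ℕ) : ℝ)) / (α ^ 2 / ((n + 1 : ℕ) : ℝ) + β ^ 2 / ((m + 1 : ℕ) : ℝ))
        * ((Measure.pi fun _ : Fin (m + 1) => gaussianReal 0 1)
          {z : Fin (m + 1) → ℝ | |z 0| ≤ t * Real.sqrt ((∑ j : Fin m, z j.succ ^ 2) / (m : ℝ))}).toReal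
    ≤ (((Measure.pi fun _ : Fin (n + 1) => gaussianReal 0 1).prod
        (Measure.pi fun _ : Fin (m + 1) => gaussianReal 0 1))
      {p : (Fin (n + 1) → ℝ) × (Fin (m + 1) → ℝ) |
        (α * ((∑ i, p.1 i) / ((n + 1 : ℕ) : ℝ)) - β * ((∑ i, p.2 i) / ((m + 1 : ℕ) : ℝ))) ^ 2
          ≤ t ^ 2 * (α ^ 2 * (((∑ j, (p.1 j - (∑ i, p.1 i) / ((n + 1 : ℕ) : ℝ)) ^ 2)
                / (((n + 1 : ℕ) : ℝ) - 1)) / ((n + 1 : ℕ) : ℝ))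
            + β ^ 2 * (((∑ j, (p.2 j - (∑ i, p.2 i) / ((m + 1 : ℕ) : ℝ)) ^ 2)
                / (((m + 1 : ℕ) : ℝ) - 1)) / ((m + 1 : ℕ) : ℝ)))}).toReal := by
  rw [pi_gaussianReal_welch_real_eq_integral ht n m hτ,
    pi_gaussianReal_studentRatio_real_eq_integral t n, pi_gaussianReal_studentRatio_real_eq_integral t m]
  set a : ℝ := ((n + 1 : ℕ) : ℝ) with ha'
  set b : ℝ := ((m + 1 : ℕ) : ℝ) with hb'
  have ha : 0 < a := by rw [ha']; positivity
  have hb : 0 < b := by rw [hb']; positivity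
  set τ2 : ℝ := α ^ 2 / a + β ^ 2 / b with hτ2
  set la : ℝ := (α ^ 2 / a) / τ2 with hla
  set lb : ℝ := (β ^ 2 / b) / τ2 with hlb
  have hla0 : 0 ≤ la := div_nonneg (div_nonneg (sq_nonneg _) ha.le) hτ.le
  have hlb0 : 0 ≤ lb := div_nonneg (div_nonneg (sq_nonneg _) hb.le) hτ.le
  have hsum : la + lb = 1 := by rw [hla, hlb, ← add_div, div_self hτ.ne']
  set Q := Measure.pi fun _ : Fin n ⊕ Fin m => gaussianReal 0 1 with hQ
  set ψ : ℝ → ℝ := fun x => (gaussianReal 0 1).real (Icc (-(t * Real.sqrt x)) (t * Real.sqrt x)) with hψ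
  have hψc : Continuous ψ := continuous_gaussianReal_real_Icc_sqrt ht
  have hψb : ∀ x, |ψ x| ≤ 1 := abs_gaussianReal_real_Icc_sqrt_le_one t
  have hconc := concaveOn_gaussianReal_real_Icc_sqrt ht
  set V1 : (Fin n ⊕ Fin m → ℝ) → ℝ := fun w => (∑ j : Fin n, w (Sum.inl j) ^ 2) / (n : ℝ) with hV1
  set V2 : (Fin n ⊕ Fin m → ℝ) → ℝ := fun w => (∑ j : Fin m, w (Sum.inr j) ^ 2) / (m : ℝ) with hV2
  have hV1m : Measurable V1 := by simp only [hV1]; fun_prop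
  have hV2m : Measurable V2 := by simp only [hV2]; fun_prop
  have hV10 : ∀ w, 0 ≤ V1 w := fun w => div_nonneg (Finset.sum_nonneg fun j _ => sq_nonneg _) (Nat.cast_nonneg n)
  have hV20 : ∀ w, 0 ≤ V2 w := fun w => div_nonneg (Finset.sum_nonneg fun j _ => sq_nonneg _) (Nat.cast_nonneg m)
  -- the two marginal integrals
  have h1 : ∫ w, ψ (V1 w) ∂Q = ∫ y, ψ ((∑ j, y j ^ 2) / (n : ℝ)) ∂(Measure.pi fun _ : Fin n => gaussianReal 0 1) :=
    pi_sum_integral_inl (fun y : Fin n → ℝ => ψ ((∑ j, y j ^ 2) / (n : ℝ)))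
      (hψc.measurable.comp (by fun_prop : Measurable fun y : Fin n → ℝ => (∑ j, y j ^ 2) / (n : ℝ))).aestronglyMeasurable
  have h2 : ∫ w, ψ (V2 w) ∂Q = ∫ y, ψ ((∑ j, y j ^ 2) / (m : ℝ)) ∂(Measure.pi fun _ : Fin m => gaussianReal 0 1) :=
    pi_sum_integral_inr (fun y : Fin m → ℝ => ψ ((∑ j, y j ^ 2) / (m : ℝ)))
      (hψc.measurable.comp (by fun_prop : Measurable fun y : Fin m → ℝ => (∑ j, y j ^ 2) / (m : ℝ))).aestronglyMeasurable
  have hint1 : Integrable (fun w => ψ (V1 w)) Q :=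
    Integrable.of_bound (hψc.measurable.comp hV1m).aestronglyMeasurable 1 (ae_of_all _ fun w => hψb _)
  have hint2 : Integrable (fun w => ψ (V2 w)) Q :=
    Integrable.of_bound (hψc.measurable.comp hV2m).aestronglyMeasurable 1 (ae_of_all _ fun w => hψb _)
  have hint : Integrable (fun w => ψ (la * V1 w + lb * V2 w)) Q :=
    Integrable.of_bound (hψc.measurable.comp ((hV1m.const_mul _).add (hV2m.const_mul _))).aestronglyMeasurable
      1 (ae_of_all _ fun w => hψb _)
  -- pointwise concavity, then integrate
  have hpt : ∀ w, la * ψ (V1 w) + lb * ψ (V2 w) ≤ ψ (la * V1 w + lb * V2 w) := fun w => by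
    have := hconc.2 (hV10 w) (hV20 w) hla0 hlb0 hsum
    simpa only [smul_eq_mul] using this
  calc la * ∫ y, ψ ((∑ j, y j ^ 2) / (n : ℝ)) ∂(Measure.pi fun _ : Fin n => gaussianReal 0 1)
        + lb * ∫ y, ψ ((∑ j, y j ^ 2) / (m : ℝ)) ∂(Measure.pi fun _ : Fin m => gaussianReal 0 1)
      = ∫ w, (la * ψ (V1 w) + lb * ψ (V2 w)) ∂Q := by
        rw [← h1, ← h2, integral_add (hint1.const_mul _) (hint2.const_mul _), integral_const_mul,
          integral_const_mul]
    _ ≤ ∫ w, ψ (la * V1 w + lb * V2 w) ∂Q :=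
        integral_mono ((hint1.const_mul _).add (hint2.const_mul _)) hint hpt

/-- **UPPER BOUND: the unequal-count two-arm criterion read with the normal quantile never
over-covers**: `W ≤ N(0,1)([−t, t])` (Jensen for the concave `ψ_t`; `E(λV₁ + λ'V₂) = 1`). [ours] -/
theorem pi_gaussianReal_welch_le_gaussian {t : ℝ} (ht : 0 ≤ t) {n m : ℕ} (hn : 1 ≤ n) (hm : 1 ≤ m)
    {α β : ℝ} (hτ : 0 < α ^ 2 / ((n + 1 : ℕ) : ℝ) + β ^ 2 / ((m + 1 : ℕ) : ℝ)) :
    (((Measure.pi fun _ : Fin (n + 1) => gaussianReal 0 1).prod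
        (Measure.pi fun _ : Fin (m + 1) => gaussianReal 0 1))
      {p : (Fin (n + 1) → ℝ) × (Fin (m + 1) → ℝ) |
        (α * ((∑ i, p.1 i) / ((n + 1 : ℕ) : ℝ)) - β * ((∑ i, p.2 i) / ((m + 1 : ℕ) : ℝ))) ^ 2
          ≤ t ^ 2 * (α ^ 2 * (((∑ j, (p.1 j - (∑ i, p.1 i) / ((n + 1 : ℕ) : ℝ)) ^ 2)
                / (((n + 1 : ℕ) : ℝ) - 1)) / ((n + 1 : ℕ) : ℝ))
            + β ^ 2 * (((∑ j, (p.2 j - (∑ i, p.2 i) / ((m + 1 : ℕ) : ℝ)) ^ 2)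
                / (((m + 1 : ℕ) : ℝ) - 1)) / ((m + 1 : ℕ) : ℝ)))}).toReal
      ≤ (gaussianReal 0 1).real (Icc (-t) t) := by
  rw [pi_gaussianReal_welch_real_eq_integral ht n m hτ]
  set a : ℝ := ((n + 1 : ℕ) : ℝ) with ha'
  set b : ℝ := ((m + 1 : ℕ) : ℝ) with hb'
  have ha : 0 < a := by rw [ha']; positivity
  have hb : 0 < b := by rw [hb']; positivity
  set τ2 : ℝ := α ^ 2 / a + β ^ 2 / b with hτ2
  set la : ℝ := (α ^ 2 / a) / τ2 with hla
  set lb : ℝ := (β ^ 2 / b) / τ2 with hlb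
  have hsum : la + lb = 1 := by rw [hla, hlb, ← add_div, div_self hτ.ne']
  set Q := Measure.pi fun _ : Fin n ⊕ Fin m => gaussianReal 0 1 with hQ
  set ψ : ℝ → ℝ := fun x => (gaussianReal 0 1).real (Icc (-(t * Real.sqrt x)) (t * Real.sqrt x)) with hψ
  have hψc : Continuous ψ := continuous_gaussianReal_real_Icc_sqrt ht
  have hψb : ∀ x, |ψ x| ≤ 1 := abs_gaussianReal_real_Icc_sqrt_le_one t
  set M : (Fin n ⊕ Fin m → ℝ) → ℝ := fun w =>
    la * ((∑ j : Fin n, w (Sum.inl j) ^ 2) / (n : ℝ)) + lb * ((∑ j : Fin m, w (Sum.inr j) ^ 2) / (m : ℝ))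
    with hM
  have hMm : Measurable M := by simp only [hM]; fun_prop
  have hla0 : 0 ≤ la := div_nonneg (div_nonneg (sq_nonneg _) ha.le) hτ.le
  have hlb0 : 0 ≤ lb := div_nonneg (div_nonneg (sq_nonneg _) hb.le) hτ.le
  have hM0 : ∀ w, M w ∈ Ici (0 : ℝ) := fun w => by
    simp only [hM, Set.mem_Ici]
    exact add_nonneg (mul_nonneg hla0 (div_nonneg (Finset.sum_nonneg fun j _ => sq_nonneg _)
      (Nat.cast_nonneg n))) (mul_nonneg hlb0 (div_nonneg (Finset.sum_nonneg fun j _ => sq_nonneg _)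
      (Nat.cast_nonneg m)))
  -- second moments: `∫ x_i² dQ = 1`, hence `∫ M dQ = la + lb = 1`
  have hsq : ∀ i : Fin n ⊕ Fin m, Integrable (fun w : Fin n ⊕ Fin m → ℝ => w i ^ 2) Q ∧
      ∫ w, w i ^ 2 ∂Q = 1 := by
    intro i
    have hev := measurePreserving_eval (fun _ : Fin n ⊕ Fin m => gaussianReal 0 1) i
    have hint' : Integrable (fun x : ℝ => x ^ 2) (Q.map fun w : Fin n ⊕ Fin m → ℝ => w i) := by
      rw [hev.map_eq]; exact Literature.Probability.Distributions.integrable_sq_gaussianReal_zero 1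
    refine ⟨hint'.comp_measurable (measurable_pi_apply i), ?_⟩
    have h1 : ∫ w, w i ^ 2 ∂Q = ∫ x, x ^ 2 ∂(Q.map fun w : Fin n ⊕ Fin m → ℝ => w i) :=
      (integral_map (φ := fun w : Fin n ⊕ Fin m → ℝ => w i) (f := fun x : ℝ => x ^ 2)
        (measurable_pi_apply (X := fun _ : Fin n ⊕ Fin m => ℝ) i).aemeasurable
        hint'.aestronglyMeasurable).symm
    rw [h1, hev.map_eq, Literature.Probability.Distributions.integral_sq_gaussianReal_zero 1, NNReal.coe_one]
  have hintM : Integrable M Q := by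
    simp only [hM]
    refine ((integrable_finsetSum _ fun j _ => (hsq (Sum.inl j)).1).div_const _ |>.const_mul _).add
      ((integrable_finsetSum _ fun j _ => (hsq (Sum.inr j)).1).div_const _ |>.const_mul _)
  have hIM : ∫ w, M w ∂Q = 1 := by
    simp only [hM]
    rw [integral_add (((integrable_finsetSum _ fun j _ => (hsq (Sum.inl j)).1).div_const _).const_mul _)
      (((integrable_finsetSum _ fun j _ => (hsq (Sum.inr j)).1).div_const _).const_mul _),
      integral_const_mul, integral_const_mul, integral_div, integral_div,
      integral_finsetSum _ fun j _ => (hsq (Sum.inl j)).1,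
      integral_finsetSum _ fun j _ => (hsq (Sum.inr j)).1]
    simp only [(hsq _).2, Finset.sum_const, Finset.card_univ, Fintype.card_fin, nsmul_eq_mul, mul_one]
    have hn0 : (n : ℝ) ≠ 0 := by exact_mod_cast (by omega : n ≠ 0)
    have hm0 : (m : ℝ) ≠ 0 := by exact_mod_cast (by omega : m ≠ 0)
    rw [div_self hn0, div_self hm0, mul_one, mul_one, hsum]
  have hJ := (concaveOn_gaussianReal_real_Icc_sqrt ht).le_map_integral (μ := Q) (f := M)
    hψc.continuousOn isClosed_Ici (ae_of_all _ hM0) hintM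
    (Integrable.of_bound (hψc.measurable.comp hMm).aestronglyMeasurable 1 (ae_of_all _ fun w => hψb _))
  rw [hIM, Real.sqrt_one, mul_one] at hJ
  exact hJ

/-- **Hsu's conservative rule, arm A the smaller**: if `a ≤ b` (`n ≤ m`, `n ≥ 1`), the one-arm
Student-ratio probability with `a − 1` squares bounds the unequal-count two-arm criterion from
below: `L_a(t) ≤ W` — reading the A-vs-B bar with the Student quantile of `min(a,b) − 1` degrees
of freedom never under-covers asymptotically (`Scoring/GaussianStudentCountMonotone` for
`L_a ≤ L_b`). [ours] -/
theorem pi_gaussianReal_welch_ge_left {t : ℝ} (ht : 0 ≤ t) {n m : ℕ} (hn : 1 ≤ n) (hnm : n ≤ m)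
    {α β : ℝ} (hτ : 0 < α ^ 2 / ((n + 1 : ℕ) : ℝ) + β ^ 2 / ((m + 1 : ℕ) : ℝ)) :
    ((Measure.pi fun _ : Fin (n + 1) => gaussianReal 0 1)
        {z : Fin (n + 1) → ℝ | |z 0| ≤ t * Real.sqrt ((∑ j : Fin n, z j.succ ^ 2) / (n : ℝ))}).toReal
    ≤ (((Measure.pi fun _ : Fin (n + 1) => gaussianReal 0 1).prod
        (Measure.pi fun _ : Fin (m + 1) => gaussianReal 0 1))
      {p : (Fin (n + 1) → ℝ) × (Fin (m + 1) → ℝ) |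
        (α * ((∑ i, p.1 i) / ((n + 1 : ℕ) : ℝ)) - β * ((∑ i, p.2 i) / ((m + 1 : ℕ) : ℝ))) ^ 2
          ≤ t ^ 2 * (α ^ 2 * (((∑ j, (p.1 j - (∑ i, p.1 i) / ((n + 1 : ℕ) : ℝ)) ^ 2)
                / (((n + 1 : ℕ) : ℝ) - 1)) / ((n + 1 : ℕ) : ℝ))
            + β ^ 2 * (((∑ j, (p.2 j - (∑ i, p.2 i) / ((m + 1 : ℕ) : ℝ)) ^ 2)
                / (((m + 1 : ℕ) : ℝ) - 1)) / ((m + 1 : ℕ) : ℝ)))}).toReal := by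
  refine le_trans ?_ (pi_gaussianReal_welch_ge_mixture ht n m hτ)
  have hmono := ENNReal.toReal_mono (measure_ne_top _ _)
    (pi_gaussianReal_studentRatio_le_of_le ht hn hnm)
  set La := ((Measure.pi fun _ : Fin (n + 1) => gaussianReal 0 1)
        {z : Fin (n + 1) → ℝ | |z 0| ≤ t * Real.sqrt ((∑ j : Fin n, z j.succ ^ 2) / (n : ℝ))}).toReal
  set Lb := ((Measure.pi fun _ : Fin (m + 1) => gaussianReal 0 1)
        {z : Fin (m + 1) → ℝ | |z 0| ≤ t * Real.sqrt ((∑ j : Fin m, z j.succ ^ 2) / (m : ℝ))}).toReal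
  have ha : (0 : ℝ) < ((n + 1 : ℕ) : ℝ) := by positivity
  have hb : (0 : ℝ) < ((m + 1 : ℕ) : ℝ) := by positivity
  set la : ℝ := (α ^ 2 / ((n + 1 : ℕ) : ℝ)) / (α ^ 2 / ((n + 1 : ℕ) : ℝ) + β ^ 2 / ((m + 1 : ℕ) : ℝ))
  set lb : ℝ := (β ^ 2 / ((m + 1 : ℕ) : ℝ)) / (α ^ 2 / ((n + 1 : ℕ) : ℝ) + β ^ 2 / ((m + 1 : ℕ) : ℝ))
  have hla0 : 0 ≤ la := div_nonneg (div_nonneg (sq_nonneg _) ha.le) hτ.le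
  have hlb0 : 0 ≤ lb := div_nonneg (div_nonneg (sq_nonneg _) hb.le) hτ.le
  have hsum : la + lb = 1 := by
    simp only [la, lb]; rw [← add_div, div_self hτ.ne']
  have h1 : lb * La ≤ lb * Lb := mul_le_mul_of_nonneg_left hmono hlb0
  have h2 : La = la * La + lb * La := by rw [← add_mul, hsum, one_mul]
  linarith

/-- **Hsu's conservative rule, arm B the smaller**: if `b ≤ a` (`m ≤ n`, `m ≥ 1`), `L_b(t) ≤ W`. [ours] -/
theorem pi_gaussianReal_welch_ge_right {t : ℝ} (ht : 0 ≤ t) {n m : ℕ} (hm : 1 ≤ m) (hmn : m ≤ n)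
    {α β : ℝ} (hτ : 0 < α ^ 2 / ((n + 1 : ℕ) : ℝ) + β ^ 2 / ((m + 1 : ℕ) : ℝ)) :
    ((Measure.pi fun _ : Fin (m + 1) => gaussianReal 0 1)
        {z : Fin (m + 1) → ℝ | |z 0| ≤ t * Real.sqrt ((∑ j : Fin m, z j.succ ^ 2) / (m : ℝ))}).toReal
    ≤ (((Measure.pi fun _ : Fin (n + 1) => gaussianReal 0 1).prod
        (Measure.pi fun _ : Fin (m + 1) => gaussianReal 0 1))
      {p : (Fin (n + 1) → ℝ) × (Fin (m + 1) → ℝ) |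
        (α * ((∑ i, p.1 i) / ((n + 1 : ℕ) : ℝ)) - β * ((∑ i, p.2 i) / ((m + 1 : ℕ) : ℝ))) ^ 2
          ≤ t ^ 2 * (α ^ 2 * (((∑ j, (p.1 j - (∑ i, p.1 i) / ((n + 1 : ℕ) : ℝ)) ^ 2)
                / (((n + 1 : ℕ) : ℝ) - 1)) / ((n + 1 : ℕ) : ℝ))
            + β ^ 2 * (((∑ j, (p.2 j - (∑ i, p.2 i) / ((m + 1 : ℕ) : ℝ)) ^ 2)
                / (((m + 1 : ℕ) : ℝ) - 1)) / ((m + 1 : ℕ) : ℝ)))}).toReal := by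
  refine le_trans ?_ (pi_gaussianReal_welch_ge_mixture ht n m hτ)
  have hmono := ENNReal.toReal_mono (measure_ne_top _ _)
    (pi_gaussianReal_studentRatio_le_of_le ht hm hmn)
  set La := ((Measure.pi fun _ : Fin (n + 1) => gaussianReal 0 1)
        {z : Fin (n + 1) → ℝ | |z 0| ≤ t * Real.sqrt ((∑ j : Fin n, z j.succ ^ 2) / (n : ℝ))}).toReal
  set Lb := ((Measure.pi fun _ : Fin (m + 1) => gaussianReal 0 1)
        {z : Fin (m + 1) → ℝ | |z 0| ≤ t * Real.sqrt ((∑ j : Fin m, z j.succ ^ 2) / (m : ℝ))}).toReal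
  have ha : (0 : ℝ) < ((n + 1 : ℕ) : ℝ) := by positivity
  have hb : (0 : ℝ) < ((m + 1 : ℕ) : ℝ) := by positivity
  set la : ℝ := (α ^ 2 / ((n + 1 : ℕ) : ℝ)) / (α ^ 2 / ((n + 1 : ℕ) : ℝ) + β ^ 2 / ((m + 1 : ℕ) : ℝ))
  set lb : ℝ := (β ^ 2 / ((m + 1 : ℕ) : ℝ)) / (α ^ 2 / ((n + 1 : ℕ) : ℝ) + β ^ 2 / ((m + 1 : ℕ) : ℝ))
  have hla0 : 0 ≤ la := div_nonneg (div_nonneg (sq_nonneg _) ha.le) hτ.le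
  have hlb0 : 0 ≤ lb := div_nonneg (div_nonneg (sq_nonneg _) hb.le) hτ.le
  have hsum : la + lb = 1 := by
    simp only [la, lb]; rw [← add_div, div_self hτ.ne']
  have h1 : la * Lb ≤ la * La := mul_le_mul_of_nonneg_left hmono hla0
  have h2 : Lb = la * Lb + lb * Lb := by rw [← add_mul, hsum, one_mul]
  linarith

end Bounds

end Summit.Ventures.LatticeQCDFlow.Scoring
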